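import Mathlib.NumberTheory.ModularForms.QExpansion
import Mathlib.NumberTheory.ModularForms.Discriminant
import Summits.Langlands.Langlands.Theorems.CapacityClassicalityCongruenceToClassicalDefs
import Summits.Langlands.Langlands.Theorems.CapacityClassicalityCongruenceToClassicalQSeries
import Summits.Langlands.Langlands.Theorems.CapacityClassicalityCongruenceToClassicalHeckeMatrices
import Summits.Langlands.Langlands.Theorems.CapacityClassicalityCongruenceToClassicalAxis

/-!
# Boundedness at the cusps from a `T_ℓ`-functional equation

Helper file for `CongruenceToClassical` (route CapacityClassicality, item stmt-Langlands-10367).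
The abstract "cusp-pole removal" theorem: let `G : ℍ → ℂ`, `k : ℤ`, `M ≥ 1`, `m : ℕ`, `ℓ` a prime
and `ψℓ ≠ 0`, `aℓ`, `c₀` complex numbers such that

* (PER) for every `γ ∈ SL(2, ℤ)` the function `(G ∣[k] γ) · Δ ^ m` has a convergent
  `q_M`-expansion `∑ bₙ q_M ^ n` on `ℍ` (`q_M = exp (2πiτ/M)`);
* (HECKE) `∑_{j < ℓ} G ∣[k] [[1,j],[0,ℓ]] + ψℓ · G ∣[k] [[ℓ,0],[0,1]] = aℓ · G + c₀` on `ℍ`.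

Then `G ∣[k] γ` is bounded at `i∞` for every `γ ∈ SL(2, ℤ)`.

Proof: downward induction on `e` in CLAIM(`e`) = "`G ∣[k] γ = O(exp(2π e Im τ / M))` for all
`γ`", from `e = m M` (trivial) to `e = 0` (the goal). For the step, the `q_M`-expansion of
`(G ∣ γ₁) Δ^m` either starts at an index `≥ mM - (e-1)` (done) or `(G ∣ γ₁) q_M^{e₀} → b ≠ 0`
with `e₀ ≥ e`; after replacing `γ₁` by `γ₁ T^t` we may assume `ℓ ∣ d` or `ℓ ∣ b`, and then the
HECKE relation slashed at `γ = [[ℓa,b],[c,d/ℓ]]` resp. `[[a,b/ℓ],[ℓc,d]]` exhibits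
`G ∣ γ₁ ∣ [[ℓ,0],[0,1]]` (growth `exp(2π e₀ ℓ Im/M)` along the imaginary axis) as a combination of
terms of growth `O(exp(2π e Im/M))` — the other `ℓ` terms are `G ∣ γ' ∣ [[1,j'],[0,ℓ]]` by the
Hermite normal form, and the defect `c₀ (cτ+d)^{-k}` is polynomial — a contradiction as `ℓ ≥ 2`.
-/

set_option linter.dupNamespace false -- project-wide option (lakefile weak.linter.dupNamespace); `Summit.Langlands.Langlands` is the mandated namespace

noncomputable section

open Complex Filter Asymptotics UpperHalfPlane Function ModularForm

open scoped Real Topology MatrixGroups ModularForm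

open Function.Periodic (qParam)

namespace Summit.Langlands.Langlands.Theorems.CapacityClassicality

/-! ## Growth bounds are stable under the Hecke matrices -/

section transfer

variable {G : ℍ → ℂ} {k : ℤ} {ℓ : ℕ} [NeZero ℓ]

/-- If `f = O(Egr c)` at `i∞` and `0 ≤ c`, then `f ∣[k] βU ℓ j = O(Egr c)`. -/
theorem isBigO_Egr_slash_βU {f : ℍ → ℂ} {c : ℝ} (hc : 0 ≤ c)
    (hf : f =O[atImInfty] Egr c) (j : ℤ) :
    (f ∣[k] βU ℓ j) =O[atImInfty] Egr c := by
  have h1 : (f ∣[k] βU ℓ j) = fun τ ↦ (ℓ : ℂ)⁻¹ * f (βU ℓ j • τ) := by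
    funext τ; rw [slash_βU_apply, div_eq_inv_mul]
  rw [h1]
  refine IsBigO.const_mul_left ?_ _
  have h2 : (fun τ ↦ f (βU ℓ j • τ)) =O[atImInfty] fun τ ↦ Egr c (βU ℓ j • τ) :=
    hf.comp_tendsto (tendsto_βU_smul j)
  refine h2.trans (isBigO_of_le _ fun τ ↦ ?_)
  rw [norm_Egr, norm_Egr, Egr_βU_smul]
  refine Egr_mono ?_ τ
  exact div_le_self hc (by exact_mod_cast Nat.one_le_iff_ne_zero.mpr (NeZero.ne ℓ))

/-- If `f = O(Egr c)` at `i∞`, then `f ∣[k] T ^ t = O(Egr c)`. -/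
theorem isBigO_Egr_slash_T_zpow {f : ℍ → ℂ} {c : ℝ} (hf : f =O[atImInfty] Egr c) (t : ℤ) :
    (f ∣[k] (ModularGroup.T ^ t)) =O[atImInfty] Egr c := by
  have h1 : (f ∣[k] (ModularGroup.T ^ t)) = fun τ ↦ f ((t : ℝ) +ᵥ τ) := by
    funext τ
    rw [SL_slash_apply, ModularGroup.denom_apply, UpperHalfPlane.modular_T_zpow_smul]
    simp [ModularGroup.coe_T_zpow]
  rw [h1]
  have htend : Tendsto (fun τ : ℍ ↦ (t : ℝ) +ᵥ τ) atImInfty atImInfty := by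
    rw [atImInfty, tendsto_comap_iff]
    have : UpperHalfPlane.im ∘ (fun τ : ℍ ↦ (t : ℝ) +ᵥ τ) = UpperHalfPlane.im := by
      funext τ; simp [vadd_im]
    rw [this]
    exact tendsto_comap
  have h2 : (fun τ ↦ f ((t : ℝ) +ᵥ τ)) =O[atImInfty] fun τ ↦ Egr c ((t : ℝ) +ᵥ τ) :=
    hf.comp_tendsto htend
  refine h2.trans (isBigO_of_le _ fun τ ↦ le_of_eq ?_)
  simp [Egr, vadd_im]

/-- CLAIM(`e`) for `γ'` gives the bound `O(Egr (e/M))` for `G ∣[k] (γ' · βU ℓ j)`. -/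
theorem isBigO_slash_coe_mul_βU {e : ℝ} (he : 0 ≤ e)
    (hclaim : ∀ γ : SL(2, ℤ), (G ∣[k] γ) =O[atImInfty] Egr e) (γ' : SL(2, ℤ)) (j : ℤ) :
    (G ∣[k] ((γ' : GL (Fin 2) ℝ) * βU ℓ j)) =O[atImInfty] Egr e := by
  rw [SlashAction.slash_mul]
  exact isBigO_Egr_slash_βU he (hclaim γ') j

/-- CLAIM(`e`) gives the bound `O(Egr e)` for `G ∣[k] μ` whenever `μ` is an integer matrix of
determinant `ℓ` whose first column is not divisible by `ℓ`. -/
theorem isBigO_slash_glOfInt (hℓ : ℓ.Prime) {e : ℝ} (he : 0 ≤ e)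
    (hclaim : ∀ γ : SL(2, ℤ), (G ∣[k] γ) =O[atImInfty] Egr e)
    {μ : Matrix (Fin 2) (Fin 2) ℤ} (hdet : μ.det = ℓ)
    (hcol : ¬ ((ℓ : ℤ) ∣ μ 0 0 ∧ (ℓ : ℤ) ∣ μ 1 0)) :
    (G ∣[k] glOfInt μ) =O[atImInfty] Egr e := by
  obtain ⟨γ', j, -, -, hμ⟩ := exists_eq_mul_matU hℓ μ hdet hcol
  rw [glOfInt_eq_coe_mul_βU hμ]
  exact isBigO_slash_coe_mul_βU he hclaim γ' j

/-- The special term: if `(G ∣[k] γ₁) · q_M ^ e₀ → β ≠ 0` at `i∞`, then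
`Egr (e₀ ℓ / M) = O(G ∣[k] (γ₁ · βV ℓ))` at `i∞`. -/
theorem Egr_isBigO_slash_coe_mul_βV {M : ℕ} {e₀ : ℕ} {β : ℂ} (hβ : β ≠ 0) (γ₁ : SL(2, ℤ))
    (hlim : Tendsto (fun τ ↦ (G ∣[k] γ₁) τ * qParam M τ ^ e₀) atImInfty (𝓝 β)) :
    Egr ((e₀ * ℓ : ℕ) / M) =O[atImInfty] (G ∣[k] ((γ₁ : GL (Fin 2) ℝ) * βV ℓ)) := by
  -- eventually `‖β‖ / 2 ≤ ‖(G ∣ γ₁) τ' · q_M τ' ^ e₀‖`, pulled back along `βV ℓ • ·`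
  have hev : ∀ᶠ τ' in atImInfty, ‖β‖ / 2 ≤ ‖(G ∣[k] γ₁) τ' * qParam M τ' ^ e₀‖ :=
    hlim.norm.eventually_const_le (by simpa using half_lt_self (norm_pos_iff.mpr hβ))
  have hev' := (tendsto_βV_smul ℓ).eventually hev
  have hβ2 : 0 < ‖β‖ / 2 := by positivity
  refine IsBigO.of_bound (2 / ‖β‖ * ‖((ℓ : ℂ) ^ (k - 1))⁻¹‖) ?_
  filter_upwards [hev'] with τ hτ
  rw [SlashAction.slash_mul, ← SL_slash, slash_βV_apply, norm_Egr]
  rw [norm_mul, norm_qParam_pow_eq_Egr, Egr_βV_smul] at hτ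
  have hℓ0 : (ℓ : ℂ) ^ (k - 1) ≠ 0 := zpow_ne_zero _ (by exact_mod_cast NeZero.ne ℓ)
  -- `hτ : ‖β‖/2 ≤ ‖A‖ * Egr (-(e₀/M) * ℓ) τ` with `A = (G ∣ γ₁) (βV • τ)`
  set A := (G ∣[k] γ₁) (βV ℓ • τ) with hA
  have hE : Egr ((e₀ * ℓ : ℕ) / M) τ * Egr (-(e₀ / M) * ℓ) τ = 1 := by
    rw [← Egr_add]
    convert Egr_zero τ using 2
    push_cast
    ring
  have h1 : Egr ((e₀ * ℓ : ℕ) / M) τ * (‖β‖ / 2) ≤ ‖A‖ := by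
    calc Egr ((e₀ * ℓ : ℕ) / M) τ * (‖β‖ / 2)
        ≤ Egr ((e₀ * ℓ : ℕ) / M) τ * (‖A‖ * Egr (-(e₀ / M) * ℓ) τ) := by
          gcongr
          exact (Egr_pos _ _).le
      _ = ‖A‖ * (Egr ((e₀ * ℓ : ℕ) / M) τ * Egr (-(e₀ / M) * ℓ) τ) := by ring
      _ = ‖A‖ := by rw [hE, mul_one]
  have hnorm : ‖((ℓ : ℂ) ^ (k - 1))⁻¹‖ * ‖(ℓ : ℂ) ^ (k - 1) * A‖ = ‖A‖ := by
    rw [norm_inv, norm_mul, inv_mul_cancel_left₀ (norm_ne_zero_iff.mpr hℓ0)]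
  calc Egr ((e₀ * ℓ : ℕ) / M) τ ≤ 2 / ‖β‖ * ‖A‖ := by
        rw [div_mul_eq_mul_div, le_div_iff₀ (norm_pos_iff.mpr hβ)]
        linarith
    _ = 2 / ‖β‖ * ‖((ℓ : ℂ) ^ (k - 1))⁻¹‖ * ‖(ℓ : ℂ) ^ (k - 1) * A‖ := by
        rw [mul_assoc, hnorm]

end transfer

/-! ## The slashed Hecke relation -/

section hecke

variable {G : ℍ → ℂ} {k : ℤ} {ℓ : ℕ} [NeZero ℓ] {ψℓ aℓ c₀ : ℂ}

omit [NeZero ℓ] in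
/-- The HECKE relation slashed at `γ ∈ SL(2, ℤ)` (pointwise). -/
theorem hecke_slash
    (hhecke : ∀ τ : ℍ, ∑ j ∈ Finset.range ℓ, (G ∣[k] βU ℓ (j : ℤ)) τ + ψℓ * (G ∣[k] βV ℓ) τ =
      aℓ * G τ + c₀)
    (γ : SL(2, ℤ)) (τ : ℍ) :
    ∑ j ∈ Finset.range ℓ, (G ∣[k] (βU ℓ (j : ℤ) * (γ : GL (Fin 2) ℝ))) τ +
      ψℓ * (G ∣[k] (βV ℓ * (γ : GL (Fin 2) ℝ))) τ =
      aℓ * (G ∣[k] γ) τ + c₀ * denom γ τ ^ (-k) := by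
  have hU : ∀ j : ℕ, (G ∣[k] (βU ℓ (j : ℤ) * (γ : GL (Fin 2) ℝ))) τ =
      (G ∣[k] βU ℓ (j : ℤ)) (γ • τ) * denom γ τ ^ (-k) := by
    intro j
    rw [SlashAction.slash_mul, ← SL_slash, SL_slash_apply]
  have hV : (G ∣[k] (βV ℓ * (γ : GL (Fin 2) ℝ))) τ =
      (G ∣[k] βV ℓ) (γ • τ) * denom γ τ ^ (-k) := by
    rw [SlashAction.slash_mul, ← SL_slash, SL_slash_apply]
  simp_rw [hU, hV, SL_slash_apply, ← Finset.sum_mul]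
  linear_combination (denom γ τ ^ (-k)) * hhecke (γ • τ)

end hecke

/-! ## The contradiction -/

section contra

variable {G : ℍ → ℂ} {k : ℤ} {M m ℓ : ℕ} {ψℓ aℓ c₀ : ℂ}

/-- A function squeezed between `Egr (e₀ ℓ / M)` from below (at `i∞`) and `O(Egr (e / M))` from
above (along the imaginary axis) cannot exist if `e < e₀ ℓ`. -/
theorem false_of_squeeze {S : ℍ → ℂ} {e e₀ : ℕ} (hM : 0 < M) (hlt : e < e₀ * ℓ)
    (hlow : Egr ((e₀ * ℓ : ℕ) / M) =O[atImInfty] S)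
    (hup : (S ∘ axisPath) =O[atTop] fun y ↦ Egr (e / M) (axisPath y)) : False := by
  refine not_isBigO_Egr_axisPath (a := (e₀ * ℓ : ℕ) / M) (b := e / M) ?_
    ((hlow.comp_tendsto tendsto_axisPath).trans hup)
  have hMr : (0 : ℝ) < M := by exact_mod_cast hM
  rw [div_lt_div_iff_of_pos_right hMr]
  exact_mod_cast hlt

/-- Terms that are `O(Egr (e/M))` at `i∞` are so along the imaginary axis. -/
lemma isBigO_axisPath_of_isBigO {f : ℍ → ℂ} {c : ℝ} (hf : f =O[atImInfty] Egr c) :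
    (f ∘ axisPath) =O[atTop] fun y ↦ Egr c (axisPath y) :=
  hf.comp_tendsto tendsto_axisPath

/-- The heart of the matter: CLAIM(`e`) with `1 ≤ e`, a cusp representative `γ₁` with `ℓ ∣ d`
or `ℓ ∣ b`, and a nonzero limit `(G ∣ γ₁) q_M ^ e₀ → β` with `e ≤ e₀` contradict the HECKE
relation. -/
theorem hecke_contra [NeZero ℓ] (hM : 0 < M) (hℓ : ℓ.Prime) (hψ : ψℓ ≠ 0)
    (hhecke : ∀ τ : ℍ, ∑ j ∈ Finset.range ℓ, (G ∣[k] βU ℓ (j : ℤ)) τ + ψℓ * (G ∣[k] βV ℓ) τ =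
      aℓ * G τ + c₀)
    {e e₀ : ℕ} (he : 1 ≤ e) (hee : e ≤ e₀)
    (hclaim : ∀ γ : SL(2, ℤ), (G ∣[k] γ) =O[atImInfty] Egr (e / M))
    (γ₁ : SL(2, ℤ)) (hdiv : (ℓ : ℤ) ∣ γ₁ 1 1 ∨ (ℓ : ℤ) ∣ γ₁ 0 1)
    {β : ℂ} (hβ : β ≠ 0)
    (hlim : Tendsto (fun τ ↦ (G ∣[k] γ₁) τ * qParam M τ ^ e₀) atImInfty (𝓝 β)) : False := by
  have he0 : (0 : ℝ) ≤ e / M := by positivity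
  have heM : (0 : ℝ) < e / M := by
    have : (0 : ℝ) < e := by exact_mod_cast he
    have hMr : (0 : ℝ) < M := by exact_mod_cast hM
    positivity
  have hlt : e < e₀ * ℓ := by
    calc e < e * 2 := by omega
      _ ≤ e₀ * ℓ := Nat.mul_le_mul hee hℓ.two_le
  -- the special term and its lower bound
  have hlow := Egr_isBigO_slash_coe_mul_βV (ℓ := ℓ) hβ γ₁ hlim
  rcases hdiv with hd | hb
  · -- Case A
    obtain ⟨γ, hγ, hUj, hV⟩ := exists_caseA hℓ γ₁ hd
    have hspecial : βU ℓ ((0 : ℕ) : ℤ) * (γ : GL (Fin 2) ℝ) = (γ₁ : GL (Fin 2) ℝ) * βV ℓ := by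
      rw [βU_mul_coe, Nat.cast_zero, hγ]
      exact glOfInt_eq_coe_mul_βV rfl
    have hid := hecke_slash hhecke γ
    -- isolate the `j = 0` term
    have h0mem : (0 : ℕ) ∈ Finset.range ℓ := Finset.mem_range.mpr hℓ.pos
    have hS : ∀ τ : ℍ, (G ∣[k] ((γ₁ : GL (Fin 2) ℝ) * βV ℓ)) τ =
        aℓ * (G ∣[k] γ) τ + c₀ * denom γ τ ^ (-k)
          - ∑ j ∈ Finset.range ℓ \ {0}, (G ∣[k] (βU ℓ (j : ℤ) * (γ : GL (Fin 2) ℝ))) τ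
          - ψℓ * (G ∣[k] (βV ℓ * (γ : GL (Fin 2) ℝ))) τ := by
      intro τ
      have := hid τ
      rw [Finset.sum_eq_add_sum_sdiff_singleton_of_mem h0mem, hspecial] at this
      linear_combination this
    refine false_of_squeeze hM hlt hlow ?_
    have hSfun : (G ∣[k] ((γ₁ : GL (Fin 2) ℝ) * βV ℓ)) = fun τ ↦
        aℓ * (G ∣[k] γ) τ + c₀ * denom γ τ ^ (-k)
          - ∑ j ∈ Finset.range ℓ \ {0}, (G ∣[k] (βU ℓ (j : ℤ) * (γ : GL (Fin 2) ℝ))) τ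
          - ψℓ * (G ∣[k] (βV ℓ * (γ : GL (Fin 2) ℝ))) τ := funext hS
    rw [hSfun]
    refine IsBigO.sub (IsBigO.sub (IsBigO.add ?_ ?_) ?_) ?_
    · exact (isBigO_axisPath_of_isBigO (hclaim γ)).const_mul_left aℓ
    · exact (isBigO_denom_zpow_axisPath γ k heM).const_mul_left c₀
    · refine isBigO_axisPath_of_isBigO (IsBigO.sum fun j hj ↦ ?_)
      rw [Finset.mem_sdiff, Finset.mem_range, Finset.mem_singleton] at hj
      rw [βU_mul_coe]
      refine isBigO_slash_glOfInt hℓ he0 hclaim ?_ (hUj j (by omega) (by omega))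
      rw [Matrix.det_mul, det_matU, Matrix.SpecialLinearGroup.det_coe, mul_one]
    · refine (isBigO_axisPath_of_isBigO ?_).const_mul_left ψℓ
      rw [βV_mul_coe]
      refine isBigO_slash_glOfInt hℓ he0 hclaim ?_ hV
      rw [Matrix.det_mul, det_matV, Matrix.SpecialLinearGroup.det_coe, mul_one]
  · -- Case B
    obtain ⟨γ, hγ, hUj⟩ := exists_caseB hℓ γ₁ hb
    have hspecial : βV ℓ * (γ : GL (Fin 2) ℝ) = (γ₁ : GL (Fin 2) ℝ) * βV ℓ := by
      rw [βV_mul_coe, hγ]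
      exact glOfInt_eq_coe_mul_βV rfl
    have hid := hecke_slash hhecke γ
    have hS : ∀ τ : ℍ, (G ∣[k] ((γ₁ : GL (Fin 2) ℝ) * βV ℓ)) τ =
        ψℓ⁻¹ * (aℓ * (G ∣[k] γ) τ + c₀ * denom γ τ ^ (-k)
          - ∑ j ∈ Finset.range ℓ, (G ∣[k] (βU ℓ (j : ℤ) * (γ : GL (Fin 2) ℝ))) τ) := by
      intro τ
      have := hid τ
      rw [hspecial] at this
      field_simp
      linear_combination this
    refine false_of_squeeze hM hlt hlow ?_
    have hSfun : (G ∣[k] ((γ₁ : GL (Fin 2) ℝ) * βV ℓ)) = fun τ ↦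
        ψℓ⁻¹ * (aℓ * (G ∣[k] γ) τ + c₀ * denom γ τ ^ (-k)
          - ∑ j ∈ Finset.range ℓ, (G ∣[k] (βU ℓ (j : ℤ) * (γ : GL (Fin 2) ℝ))) τ) := funext hS
    rw [hSfun]
    refine (IsBigO.sub (IsBigO.add ?_ ?_) ?_).const_mul_left _
    · exact (isBigO_axisPath_of_isBigO (hclaim γ)).const_mul_left aℓ
    · exact (isBigO_denom_zpow_axisPath γ k heM).const_mul_left c₀
    · refine isBigO_axisPath_of_isBigO (IsBigO.sum fun j _ ↦ ?_)
      rw [βU_mul_coe]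
      refine isBigO_slash_glOfInt hℓ he0 hclaim ?_ (hUj j)
      rw [Matrix.det_mul, det_matU, Matrix.SpecialLinearGroup.det_coe, mul_one]

end contra

/-! ## The induction -/

section induction

variable {G : ℍ → ℂ} {k : ℤ} {M m ℓ : ℕ} {ψℓ aℓ c₀ : ℂ}

/-- The inductive step CLAIM(`e`) ⇒ CLAIM(`e - 1`). -/
theorem claim_step [NeZero ℓ] (hM : 0 < M) (hℓ : ℓ.Prime) (hψ : ψℓ ≠ 0)
    (hper : ∀ γ : SL(2, ℤ), ∃ b : ℕ → ℂ, ∀ τ : ℍ,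
      HasSum (fun n ↦ b n * qParam M τ ^ n) ((G ∣[k] γ) τ * ModularForm.discriminant τ ^ m))
    (hhecke : ∀ τ : ℍ, ∑ j ∈ Finset.range ℓ, (G ∣[k] βU ℓ (j : ℤ)) τ + ψℓ * (G ∣[k] βV ℓ) τ =
      aℓ * G τ + c₀)
    {e : ℕ} (he : 1 ≤ e) (heM : e ≤ m * M)
    (hclaim : ∀ γ : SL(2, ℤ), (G ∣[k] γ) =O[atImInfty] Egr (e / M)) (γ₀ : SL(2, ℤ)) :
    (G ∣[k] γ₀) =O[atImInfty] Egr ((e - 1 : ℕ) / M) := by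
  -- choose a good representative `γ₁ = γ₀ T^t`
  obtain ⟨t, ht⟩ := exists_T_zpow_dvd hℓ γ₀
  set γ₁ := γ₀ * ModularGroup.T ^ t with hγ₁
  suffices h : (G ∣[k] γ₁) =O[atImInfty] Egr ((e - 1 : ℕ) / M) by
    have : G ∣[k] γ₀ = (G ∣[k] γ₁) ∣[k] (ModularGroup.T ^ (-t)) := by
      rw [hγ₁, ← SlashAction.slash_mul, mul_assoc, ← zpow_add, add_neg_cancel, zpow_zero, mul_one]
    rw [this]
    exact isBigO_Egr_slash_T_zpow h (-t)
  obtain ⟨b, hb⟩ := hper γ₁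
  set n₁ := m * M - (e - 1) with hn₁
  by_cases hvan : ∀ n < n₁, b n = 0
  · have := isBigO_Egr_of_hasSum hM (n₁ := n₁) (by omega) hvan hb
    have hn : m * M - n₁ = e - 1 := by omega
    rwa [hn] at this
  · push Not at hvan
    -- least index with a nonzero coefficient
    classical
    let n₀ := Nat.find hvan
    have hn₀ : n₀ < n₁ ∧ b n₀ ≠ 0 := Nat.find_spec hvan
    have hmin : ∀ n < n₀, b n = 0 := by
      intro n hn
      by_contra hbn
      exact Nat.find_min hvan hn ⟨lt_trans hn hn₀.1, hbn⟩
    have hlim := tendsto_mul_qParam_pow_of_hasSum hM (n₀ := n₀) (by omega) hmin hb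
    exfalso
    exact hecke_contra hM hℓ hψ hhecke he (e₀ := m * M - n₀) (by omega) hclaim γ₁ ht hn₀.2 hlim

/-- **Cusp-pole removal.** Under (PER) and (HECKE), every `SL(2, ℤ)`-translate of `G` is bounded
at `i∞`. -/
theorem isBoundedAtImInfty_slash_of_hecke [NeZero ℓ] (hM : 0 < M) (hℓ : ℓ.Prime) (hψ : ψℓ ≠ 0)
    (hper : ∀ γ : SL(2, ℤ), ∃ b : ℕ → ℂ, ∀ τ : ℍ,
      HasSum (fun n ↦ b n * qParam M τ ^ n) ((G ∣[k] γ) τ * ModularForm.discriminant τ ^ m))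
    (hhecke : ∀ τ : ℍ, ∑ j ∈ Finset.range ℓ, (G ∣[k] βU ℓ (j : ℤ)) τ + ψℓ * (G ∣[k] βV ℓ) τ =
      aℓ * G τ + c₀)
    (γ : SL(2, ℤ)) : IsBoundedAtImInfty (G ∣[k] γ) := by
  have key : ∀ d : ℕ, d ≤ m * M →
      ∀ γ : SL(2, ℤ), (G ∣[k] γ) =O[atImInfty] Egr (((m * M - d : ℕ) : ℝ) / M) := by
    intro d
    induction d with
    | zero =>
      intro _ γ
      obtain ⟨b, hb⟩ := hper γ
      exact isBigO_Egr_of_hasSum hM (n₁ := 0) (Nat.zero_le _) (fun n hn ↦ absurd hn (by omega)) hb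
    | succ d ih =>
      intro hd γ
      have := claim_step hM hℓ hψ hper hhecke (e := m * M - d) (by omega) (by omega)
        (ih (by omega)) γ
      have hn : m * M - d - 1 = m * M - (d + 1) := by omega
      rwa [hn] at this
  have := key (m * M) le_rfl γ
  simp only [Nat.sub_self, CharP.cast_eq_zero, zero_div] at this
  change (G ∣[k] γ) =O[atImInfty] (1 : ℍ → ℝ)
  refine this.trans (isBigO_of_le _ fun τ ↦ ?_)
  simp

end induction

end Summit.Langlands.Langlands.Theorems.CapacityClassicality
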